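import Mathlib
import Summits.Ventures.HodgeRepro2.T5AdicCompletionUnitIndex
import Summits.Ventures.HodgeRepro2.T5AdicCompletionGaloisInvariance
import Summits.Ventures.HodgeRepro2.T5ExistsCharacter
import Summits.Ventures.HodgeRepro2.T5QuadraticBasis
import Summits.Ventures.HodgeRepro2.T6N5LocalHypSmooth
import Summits.Ventures.HodgeRepro2.T6N5LocalSmooth
import Summits.Ventures.HodgeRepro2.T6N5LocalWeilQuotient
import Summits.Ventures.HodgeRepro2.T6N5LocalWeilQuotientSmooth
import Summits.Ventures.HodgeRepro2.T6N5LocalQuotientToy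
import Summits.Ventures.HodgeRepro2.T6N5LocalRamToyEps
import Summits.Ventures.HodgeRepro2.T6N5LocalRamToyEpsDisplays

/-!
# T6N5LocalRamWitness — Tier 6, M2 sub-step N5 (t6-p8's half): THE COMPLETION-LEVEL WITNESS (README §10.5(ii)(c),(d))
for the ramified statement of record v2 — every hypothesis of `N5Local_main_ram_completion_weil''` instantiated
jointly on Mathlib's completions at ANY ramified place, and the coupled local system solved there

Over a ramified place `Q : RamPlace v w` (`T6N5LocalRamToyEps`):
* `exists_psi_trivial_on_base`: a continuous non-trivial additive character `ψ_δ` of `L_w` trivial on `K_v` exists —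
  `y ↦ ψ_L((x₀/δ)(y − σy))` for a continuous non-trivial `ψ_L` (p4's `T5ExistsCharacter`), an anti-invariant `δ ≠ 0`
  (p4's `T5QuadraticBasis`) and `σ` continuous (p4's `T5AdicCompletionGaloisInvariance`);
* `toAddCharQ`: a conjugate-orthogonal character of `E_v^×` descends to `U(V) = E_v^×/F_v^×` (`ofOneQ_toAddCharQ`);
* the toy Weil representation `weilT` (`T6N5LocalQuotientToy` with `sgn = ε_v(χ_W⁻¹ ·)`) and the toy parameters
  `toyP` satisfy EVERY hypothesis of the statement of record v2: the displays (`hT6_toy`, `hG_toy`, `h35_toy` — the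
  defined theta predicate IS the sign condition on the print's characters), finite-index smoothness (p4's
  `[E_v^× : F_v^× U_E^n] < ∞`), open smoothness, non-vanishing (both signs occur), `ϵ_δ(W) = 1`, `χ_W`
  conjugate-symplectic;
* `exists_localSolution_ram`: Theorem N5.T2 at the place, instantiated — the coupled local system is solved on the
  genuine carriers `L_w^× ⊇ K_v^×`.
README §8(d): uses an L-value-free non-vanishing device: NO.
-/

namespace Summit.Ventures.HodgeRepro2.T6.N5LocalRamWitness

open Summit.Ventures.HodgeRepro2 IsDedekindDomain HeightOneSpectrum
  Summit.Ventures.HodgeRepro2.T6.N5LocalDatum Summit.Ventures.HodgeRepro2.T6.N5LocalWeil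
  Summit.Ventures.HodgeRepro2.T6.N5LocalCharDatum Summit.Ventures.HodgeRepro2.T6.N5Local
  Summit.Ventures.HodgeRepro2.T6.N5LocalSmooth Summit.Ventures.HodgeRepro2.T6.N5LocalRamWeil
  Summit.Ventures.HodgeRepro2.T6.Hyp Summit.Ventures.HodgeRepro2.T6.N5LocalInertCompletion
  Summit.Ventures.HodgeRepro2.T6.N5LocalRamCompletion Summit.Ventures.HodgeRepro2.T6.N5LocalRamOnCompletion
  Summit.Ventures.HodgeRepro2.T6.N5LocalTateChars Summit.Ventures.HodgeRepro2.T6.N5LocalRamTateSide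
  Summit.Ventures.HodgeRepro2.T6.N5LocalOnCompletionWeil Summit.Ventures.HodgeRepro2.T6.N5LocalWeilQuotient
  Summit.Ventures.HodgeRepro2.T6.N5LocalWeilQuotientSmooth Summit.Ventures.HodgeRepro2.T6.N5LocalQuotientToy
  Summit.Ventures.HodgeRepro2.T6.N5LocalRamToyEps Summit.Ventures.HodgeRepro2.T5SmoothIsotypic

-- `K`, `L` in `Type` (universe `0`).
variable {K : Type} [Field K] [NumberField K] {v : HeightOneSpectrum (NumberField.RingOfIntegers K)}
  {L : Type} [Field L] [NumberField L] [Algebra K L] {w : HeightOneSpectrum (NumberField.RingOfIntegers L)}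
  [w.asIdeal.LiesOver v.asIdeal]
  [ContinuousSMul (v.adicCompletion K) (w.adicCompletion L)]
  [IsScalarTower K (v.adicCompletion K) (w.adicCompletion L)]

noncomputable section

/-! ### A continuous non-trivial additive character of `L_w` trivial on `K_v` -/

/-- The additive character `y ↦ ψ_L(c·(y − σy))` of `L_w`. -/
def psiAnti (σ : Gal(w.adicCompletion L/v.adicCompletion K)) (ψL : AddChar (w.adicCompletion L) Circle)
    (c : w.adicCompletion L) : AddChar (w.adicCompletion L) Circle where
  toFun y := ψL (c * (y - σ y))
  map_zero_eq_one' := by simp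
  map_add_eq_mul' a b := by
    rw [← AddChar.map_add_eq_mul]
    congr 1
    rw [map_add]
    ring

omit [ContinuousSMul (v.adicCompletion K) (w.adicCompletion L)]
  [IsScalarTower K (v.adicCompletion K) (w.adicCompletion L)] in
/-- The value of `psiAnti`. -/
theorem psiAnti_apply (σ : Gal(w.adicCompletion L/v.adicCompletion K)) (ψL : AddChar (w.adicCompletion L) Circle)
    (c y : w.adicCompletion L) : psiAnti σ ψL c y = ψL (c * (y - σ y)) := rfl

omit [ContinuousSMul (v.adicCompletion K) (w.adicCompletion L)]
  [IsScalarTower K (v.adicCompletion K) (w.adicCompletion L)] in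
/-- `psiAnti` is trivial on `K_v`. -/
theorem psiAnti_algebraMap (σ : Gal(w.adicCompletion L/v.adicCompletion K))
    (ψL : AddChar (w.adicCompletion L) Circle) (c : w.adicCompletion L) (a : v.adicCompletion K) :
    psiAnti σ ψL c (algebraMap (v.adicCompletion K) (w.adicCompletion L) a) = 1 := by
  rw [psiAnti_apply, AlgEquiv.commutes, sub_self, mul_zero, AddChar.map_zero_eq_one]

/-- `psiAnti` is continuous when `ψ_L` is (`σ` is continuous: p4's `continuous_algEquiv`). -/
theorem continuous_psiAnti (σ : Gal(w.adicCompletion L/v.adicCompletion K))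
    (ψL : AddChar (w.adicCompletion L) Circle) (hψ : Continuous ψL) (c : w.adicCompletion L) :
    Continuous (psiAnti σ ψL c) := by
  have h : ⇑(psiAnti σ ψL c) = fun y => ψL (c * (y - σ y)) := funext fun y => psiAnti_apply σ ψL c y
  rw [h]
  exact hψ.comp (continuous_const.mul (continuous_id.sub
    (T5AdicCompletionGaloisInvariance.continuous_algEquiv v w σ)))

/-- THE DATUM'S `ψ_δ` EXISTS: a continuous non-trivial additive character of `L_w` trivial on `K_v`. -/
theorem exists_psi_trivial_on_base (h2 : Module.finrank (v.adicCompletion K) (w.adicCompletion L) = 2)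
    (σ : Gal(w.adicCompletion L/v.adicCompletion K)) (hσ : σ ≠ 1) :
    ∃ ψδ : PsiC w, ∀ a : v.adicCompletion K, ψδ.1 (algebraMap (v.adicCompletion K) (w.adicCompletion L) a) = 1 := by
  obtain ⟨ψL, hψc, hψ1⟩ := T5ExistsCharacter.exists_continuous_ne_one_adicCompletion (K := L) w
  obtain ⟨x₀, hx₀⟩ := AddChar.ne_one_iff.mp hψ1
  obtain ⟨δ, hδσ, hδ0⟩ := T5QuadraticBasis.exists_anti_ne_zero h2 σ hσ
  refine ⟨⟨psiAnti σ ψL (x₀ / δ), continuous_psiAnti σ ψL hψc _, ?_⟩, psiAnti_algebraMap σ ψL _⟩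
  rw [AddChar.ne_one_iff]
  refine ⟨δ / 2, ?_⟩
  rw [psiAnti_apply, map_div₀, hδσ, map_ofNat]
  have h2' : (2 : w.adicCompletion L) ≠ 0 := two_ne_zero
  have hval : x₀ / δ * (δ / 2 - -δ / 2) = x₀ := by
    field_simp
    ring
  rw [hval]
  exact hx₀

/-! ### Conjugate-orthogonal characters descend to the quotient -/

omit [ContinuousSMul (v.adicCompletion K) (w.adicCompletion L)]
  [IsScalarTower K (v.adicCompletion K) (w.adicCompletion L)] in
/-- The additive character of `U(V) = E_v^×/F_v^×` attached to a character of `E_v^×` trivial on `F_v^×`. -/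
def toAddCharQ (ξ : (w.adicCompletion L)ˣ →* ℂˣ) (h : Fsub v w ≤ ξ.ker) : AddChar (QuotA v w) ℂ where
  toFun a := ((QuotientGroup.lift (Fsub v w) ξ h (Additive.toMul a) : ℂˣ) : ℂ)
  map_zero_eq_one' := by simp
  map_add_eq_mul' a b := by simp [toMul_add]

omit [ContinuousSMul (v.adicCompletion K) (w.adicCompletion L)]
  [IsScalarTower K (v.adicCompletion K) (w.adicCompletion L)] in
/-- `ofOneQ ∘ toAddCharQ = id`: every conjugate-orthogonal character of `E_v^×` is an `α_K`. -/
theorem ofOneQ_toAddCharQ (ξ : (w.adicCompletion L)ˣ →* ℂˣ) (h : Fsub v w ≤ ξ.ker) :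
    ofOneQ v w (toAddCharQ ξ h) = ξ := by
  refine MonoidHom.ext fun x => Units.ext ?_
  rw [ofOneQ_apply]
  show ((QuotientGroup.lift (Fsub v w) ξ h (Additive.toMul (Additive.ofMul
    (x : (w.adicCompletion L)ˣ ⧸ Fsub v w))) : ℂˣ) : ℂ) = _
  rw [toMul_ofMul, QuotientGroup.lift_mk]

/-! ### The witness at a ramified place -/

section Place

variable (Q : RamPlace v w) (ψδ : PsiC w)

/-- The sign function `ξ ↦ ε_v(χ_W⁻¹·ξ)` of the toy datum (`χ_W = χWt`). -/
abbrev sgnT : ((w.adicCompletion L)ˣ →* ℂˣ) → ℤˣ := fun ξ => (Q.Dt ψδ).eps (Q.χWt⁻¹ * ξ)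

/-- The toy Weil representations over `U(V) = E_v^×/F_v^×` for the toy datum. -/
abbrev weilT : WeilRep v w := weilRep v w (Uπ w Q.π) (sgnT Q ψδ)

/-- The toy ramified Weil datum: the toy parameters, `ψ_δ`, and the toy Weil representations on the quotient
carrier. -/
abbrev XT : RamWeilDatum := mkRamWeil v w Q.h2 Q.hπ Q.σ Q.hσ Q.toyP ψδ (toCarrier v w (weilT Q ψδ))

omit [IsScalarTower K (v.adicCompletion K) (w.adicCompletion L)] in
/-- `[E_v^× : F_v^× U_E^n] < ∞` for every `n` (p4's `T5AdicCompletionUnitIndex` for `n ≥ 1`; `n = 0` by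
antitonicity). -/
theorem finiteIndex_Fsub_sup_Uπ (n : ℕ) : (Fsub v w ⊔ Uπ w Q.π n).FiniteIndex := by
  have hϖ' : Valued.v ((Q.ϖ : v.adicCompletionIntegers K) : v.adicCompletion K) = WithZero.exp (-1) :=
    (T5AdicCompletionConductor.irreducible_iff_val_eq_exp_neg_one v Q.ϖ).mp Q.hϖ
  have h1 : (Fsub v w ⊔ Uπ w Q.π 1).FiniteIndex := by
    haveI : Finite ((w.adicCompletion L)ˣ ⧸ (Fsub v w ⊔ Uπ w Q.π 1)) :=
      T5AdicCompletionUnitIndex.finite_quotient_range_baseUnits_sup_map_higherUnits v w hϖ' Q.hπ le_rfl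
    exact Subgroup.finiteIndex_of_finite_quotient
  rcases Nat.eq_zero_or_pos n with hn | hn
  · subst hn
    exact Subgroup.finiteIndex_of_le (sup_le_sup_left (Uπ_antitone w Q.π (Nat.zero_le 1)) _)
  · haveI : Finite ((w.adicCompletion L)ˣ ⧸ (Fsub v w ⊔ Uπ w Q.π n)) :=
      T5AdicCompletionUnitIndex.finite_quotient_range_baseUnits_sup_map_higherUnits v w hϖ' Q.hπ hn
    exact Subgroup.finiteIndex_of_finite_quotient

omit [ContinuousSMul (v.adicCompletion K) (w.adicCompletion L)] in
/-- The defined theta predicate of the toy Weil datum is membership in `Good s`. -/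
theorem thetaOf_iff (s : ℤˣ) (ξ : (w.adicCompletion L)ˣ →* ℂˣ) :
    (XT Q ψδ).toWeil.thetaOf s ξ ↔ ξ ∈ Good v w (Uπ w Q.π) (sgnT Q ψδ) s := by
  constructor
  · rintro ⟨α, hα, hne⟩
    have hne' : isoQ v w (Uπ w Q.π) (sgnT Q ψδ) s α ≠ ⊥ := hne
    have h := (isotypic_ne_bot_iff v w (Uπ w Q.π) (sgnT Q ψδ) s α).mp hne'
    have hα' : ofOneQ v w α = ξ := hα
    rwa [hα'] at h
  · intro h
    have hker : Fsub v w ≤ ξ.ker := fun f hf => MonoidHom.mem_ker.mpr (h.1 f hf)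
    refine ⟨toAddCharQ ξ hker, ofOneQ_toAddCharQ ξ hker, ?_⟩
    show isoQ v w (Uπ w Q.π) (sgnT Q ψδ) s (toAddCharQ ξ hker) ≠ ⊥
    rw [isotypic_ne_bot_iff, ofOneQ_toAddCharQ]
    exact h

omit [ContinuousSMul (v.adicCompletion K) (w.adicCompletion L)] in
/-- THE EPSILON DICHOTOMY (restricted to the print's characters) HOLDS for the defined theta predicate of the toy
Weil datum. -/
theorem h35_toy : BFGYYZ2025_Thm3_5_smooth (XT Q ψδ).toWeil.toLocalSignDatum (XT Q ψδ).D.IsSmooth := by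
  intro s α hα hαs
  change (w.adicCompletion L)ˣ →* ℂˣ at α
  have hCO : ∀ f ∈ Fsub v w, α f = 1 := fun f hf =>
    (CharDatum.isCO_iff (Q.Dt ψδ).toCharDatum α).mp hα ⟨f, hf⟩
  have hs : ∃ n, Uπ w Q.π n ≤ α.ker := hαs
  show (XT Q ψδ).toWeil.thetaOf s α ↔ (Q.Dt ψδ).eps (Q.χWt⁻¹ * α) = s * 1
  rw [thetaOf_iff, mul_one]
  constructor
  · intro h
    exact h.2.2
  · intro h
    exact ⟨hCO, hs, h⟩

/-- Both signs occur on smooth conjugate-orthogonal characters: `Good s` is non-empty for every `s`. -/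
theorem good_nonempty
    (hK : ∀ a : v.adicCompletion K, ψδ.1 (algebraMap (v.adicCompletion K) (w.adicCompletion L) a) = 1)
    (s : ℤˣ) : ∃ ξ, ξ ∈ Good v w (Uπ w Q.π) (sgnT Q ψδ) s := by
  obtain ⟨α, hα, hαs, heps⟩ := Q.exists_isCO_eps_inv_χW_mul_eq ψδ hK s
  change (w.adicCompletion L)ˣ →* ℂˣ at α
  refine ⟨α, fun f hf => (CharDatum.isCO_iff (Q.Dt ψδ).toCharDatum α).mp hα ⟨f, hf⟩, hαs, ?_⟩
  exact heps

omit [ContinuousSMul (v.adicCompletion K) (w.adicCompletion L)] in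
/-- `χ_W` of the toy datum is conjugate-symplectic. -/
theorem hχW_toy : (XT Q ψδ).toWeil.toLocalSignDatum.IsCS Q.toyP.χW := by
  refine (CharDatum.isCS_iff (Q.Dt ψδ).toCharDatum _).mpr fun x => ?_
  exact Q.χWt_spec.1 ⟨x.1, x.2⟩

/-- THE WITNESS: every hypothesis of `N5Local_main_ram_completion_weil''` holds jointly on the toy data over a
ramified place, and the coupled local system is solved there (Theorem N5.T2 instantiated on Mathlib's completions). -/
theorem exists_localSolution_ram
    (hK : ∀ a : v.adicCompletion K, ψδ.1 (algebraMap (v.adicCompletion K) (w.adicCompletion L) a) = 1) :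
    ∃ ξ : Fin 4 → (w.adicCompletion L)ˣ →* ℂˣ, LocalSolution (XT Q ψδ).toWeil.toLocalSignDatum ξ := by
  haveI : ∀ s, Nontrivial ((weilT Q ψδ).Wsp s) := fun s =>
    nontrivial_wsp v w (Uπ w Q.π) (sgnT Q ψδ) (good_nonempty Q ψδ hK) s
  exact N5Local_main_ram_completion_weil'' v w Q.h2 Q.hϖ Q.hπ Q.hram Q.σ Q.hσ Q.toyP ψδ (weilT Q ψδ) hK
    (Q.hT6_toy ψδ) (Q.hG_toy ψδ) (h35_toy Q ψδ)
    (fun s => isSmoothCompact v w (Uπ w Q.π) (sgnT Q ψδ) (finiteIndex_Fsub_sup_Uπ Q) s)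
    (fun s => isSmoothOpen v w (Uπ w Q.π) (sgnT Q ψδ) (Uπ_antitone w Q.π) s) rfl (hχW_toy Q ψδ)

/-- THE WITNESS WITH `ψ_δ` SUPPLIED: at every ramified place the hypothesis set of the statement of record v2 is
satisfiable, and the local system is solved — with the datum's `ψ_δ` constructed (`exists_psi_trivial_on_base`). -/
theorem exists_psi_localSolution_ram :
    ∃ ψδ : PsiC w, (∀ a : v.adicCompletion K, ψδ.1 (algebraMap (v.adicCompletion K) (w.adicCompletion L) a) = 1) ∧
      ∃ ξ : Fin 4 → (w.adicCompletion L)ˣ →* ℂˣ, LocalSolution (XT Q ψδ).toWeil.toLocalSignDatum ξ := by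
  obtain ⟨ψδ, hK⟩ := exists_psi_trivial_on_base Q.h2 Q.σ Q.hσ
  exact ⟨ψδ, hK, exists_localSolution_ram Q ψδ hK⟩

end Place

end

end Summit.Ventures.HodgeRepro2.T6.N5LocalRamWitness
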